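import Summits.CriticalPhenomena.PercolationContinuityZ3.Theorems.PercNearOneGluingAdditiveGluingFingerBridgeGraph
import HarnessLib

/-! # Crux `PercNearOneGluing.AdditiveGluing` (stmt-CriticalPhenomena-4576) — reachability after adding a CONNECTED set of pairs
# (seat (b) V⁺-form, depth prover `png-dp-vplus`)

Support file (`--supports stmt-CriticalPhenomena-4576`); no definitions, no named facts.

The pattern values of `…FingerPatternValues(B).lean` are probabilities of events `{u ↔ v in ω' ∪ Q}` where `ω'` is the configuration off the block and `Q`
is a bridge graph / clique on a set `W` of relays.  When the pairs of `Q` form a connected graph on `W`, reachability in `ω' ∪ Q` reduces to reachability in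
`ω'` alone:  `u ↔_{ω'∪Q} v  iff  u ↔_{ω'} v  or  (u ↔_{ω'} W and W ↔_{ω'} v)`  (`reach_union_connected_iff`).  This is the pointwise bookkeeping behind the
restricted-hypothesis certificates (evidence `BCORE-certificate.md` on the item).  [folklore]
-/

namespace Summit.CriticalPhenomena.PercolationContinuityZ3.Theorems

open MeasureTheory Set
open Literature.Probability.Percolation (BondConfig openConn openGraph)

noncomputable section
open Classical

section FingerReachUnion

open Literature.Probability.Percolation

variable {n : ℕ}

/-- Adding pairs can only help. [folklore] -/
theorem reach_mono_union_left {ω' Q : Set (Sym2 (Fin n))} {u v : Fin n} (h : (openGraph (ω' : BondConfig (Fin n))).Reachable u v) :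
    (openGraph ((ω' ∪ Q : Set (Sym2 (Fin n))) : BondConfig (Fin n))).Reachable u v :=
  h.mono (SimpleGraph.fromEdgeSet_mono Set.subset_union_left)

/-- **Reachability after adding a connected set of pairs.**  `Q` a set of pairs all of whose endpoints lie in `W`, and any two vertices of `W` joined by
`Q` alone (`hconn`).  Then `u ↔ v` in `ω' ∪ Q` iff `u ↔ v` in `ω'`, or `u ↔_{ω'} x` and `y ↔_{ω'} v` for some `x, y ∈ W`. [folklore] -/
theorem reach_union_connected_iff {ω' Q : Set (Sym2 (Fin n))} {W : Finset (Fin n)}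
    (hQW : ∀ e ∈ Q, ∀ z ∈ e, z ∈ W)
    (hconn : ∀ x ∈ W, ∀ y ∈ W, (openGraph (Q : BondConfig (Fin n))).Reachable x y) (u v : Fin n) :
    (openGraph ((ω' ∪ Q : Set (Sym2 (Fin n))) : BondConfig (Fin n))).Reachable u v ↔
      ((openGraph (ω' : BondConfig (Fin n))).Reachable u v ∨
        ((∃ x ∈ W, (openGraph (ω' : BondConfig (Fin n))).Reachable u x) ∧ (∃ y ∈ W, (openGraph (ω' : BondConfig (Fin n))).Reachable y v))) := by
  constructor
  · rintro ⟨p⟩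
    -- invariant along the walk
    suffices key : ∀ (a z : Fin n) (r : (openGraph ((ω' ∪ Q : Set (Sym2 (Fin n))) : BondConfig (Fin n))).Walk a z),
        ((openGraph (ω' : BondConfig (Fin n))).Reachable u a ∨
          ((∃ x ∈ W, (openGraph (ω' : BondConfig (Fin n))).Reachable u x) ∧ (∃ y ∈ W, (openGraph (ω' : BondConfig (Fin n))).Reachable y a))) →
        ((openGraph (ω' : BondConfig (Fin n))).Reachable u z ∨
          ((∃ x ∈ W, (openGraph (ω' : BondConfig (Fin n))).Reachable u x) ∧ (∃ y ∈ W, (openGraph (ω' : BondConfig (Fin n))).Reachable y z))) from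
      key u v p (Or.inl (SimpleGraph.Reachable.refl _))
    intro a z r
    induction r with
    | nil => exact id
    | cons hadj r ih =>
      intro ha
      refine ih ?_
      rename_i a' z' _
      obtain ⟨hmem, hne⟩ := (openGraph_adj _ a' z').1 hadj
      rcases hmem with hω | hQ
      · have hstep : (openGraph (ω' : BondConfig (Fin n))).Reachable a' z' := ((openGraph_adj _ a' z').2 ⟨hω, hne⟩).reachable
        rcases ha with h | ⟨hx, y, hy, hya⟩
        · exact Or.inl (h.trans hstep)
        · exact Or.inr ⟨hx, y, hy, hya.trans hstep⟩
      · -- a `Q`-step: both endpoints lie in `W`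
        have ha'W : a' ∈ W := hQW _ hQ a' (Sym2.mem_mk_left a' z')
        have hz'W : z' ∈ W := hQW _ hQ z' (Sym2.mem_mk_right a' z')
        right
        refine ⟨?_, z', hz'W, SimpleGraph.Reachable.refl _⟩
        rcases ha with h | ⟨hx, -⟩
        · exact ⟨a', ha'W, h⟩
        · exact hx
  · rintro (h | ⟨⟨x, hx, hux⟩, ⟨y, hy, hyv⟩⟩)
    · exact reach_mono_union_left h
    · have hxy : (openGraph ((ω' ∪ Q : Set (Sym2 (Fin n))) : BondConfig (Fin n))).Reachable x y :=
        (hconn x hx y hy).mono (SimpleGraph.fromEdgeSet_mono Set.subset_union_right)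
      exact ((reach_mono_union_left hux).trans hxy).trans (reach_mono_union_left hyv)

/-- Special case `Q = ∅`: nothing changes. -/
theorem reach_union_empty_iff {ω' : Set (Sym2 (Fin n))} (u v : Fin n) :
    (openGraph ((ω' ∪ (∅ : Set (Sym2 (Fin n))) : Set (Sym2 (Fin n))) : BondConfig (Fin n))).Reachable u v ↔
      (openGraph (ω' : BondConfig (Fin n))).Reachable u v := by
  rw [Set.union_empty]

/-- A single pair `s(x, y)` (`x ≠ y`) is a connected set of pairs on `{x, y}`. -/
theorem pair_connected (x y : Fin n) (hxy : x ≠ y) :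
    ∀ x' ∈ ({x, y} : Finset (Fin n)), ∀ y' ∈ ({x, y} : Finset (Fin n)),
      (openGraph (({s(x, y)} : Set (Sym2 (Fin n))) : BondConfig (Fin n))).Reachable x' y' := by
  have hadj : (openGraph (({s(x, y)} : Set (Sym2 (Fin n))) : BondConfig (Fin n))).Reachable x y :=
    ((openGraph_adj _ x y).2 ⟨Set.mem_singleton _, hxy⟩).reachable
  intro x' hx' y' hy'
  simp only [Finset.mem_insert, Finset.mem_singleton] at hx' hy'
  rcases hx' with rfl | rfl <;> rcases hy' with rfl | rfl
  · exact SimpleGraph.Reachable.refl _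
  · exact hadj
  · exact hadj.symm
  · exact SimpleGraph.Reachable.refl _

/-- **Reachability after adding one pair.**  `u ↔ v` in `ω' ∪ {s(x,y)}` iff `u ↔ v`, or (`u ↔ x` or `u ↔ y`) and (`x ↔ v` or `y ↔ v`), all in `ω'`. [folklore] -/
theorem reach_union_pair_iff {ω' : Set (Sym2 (Fin n))} (x y : Fin n) (hxy : x ≠ y) (u v : Fin n) :
    (openGraph ((ω' ∪ {s(x, y)} : Set (Sym2 (Fin n))) : BondConfig (Fin n))).Reachable u v ↔
      ((openGraph (ω' : BondConfig (Fin n))).Reachable u v ∨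
        (((openGraph (ω' : BondConfig (Fin n))).Reachable u x ∨ (openGraph (ω' : BondConfig (Fin n))).Reachable u y) ∧
         ((openGraph (ω' : BondConfig (Fin n))).Reachable x v ∨ (openGraph (ω' : BondConfig (Fin n))).Reachable y v))) := by
  have h := reach_union_connected_iff (ω' := ω') (Q := ({s(x, y)} : Set (Sym2 (Fin n)))) (W := ({x, y} : Finset (Fin n)))
    (by
      intro e he z hz
      rw [Set.mem_singleton_iff.1 he] at hz
      rcases Sym2.mem_iff.1 hz with rfl | rfl <;> simp)
    (pair_connected x y hxy) u v
  rw [h]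
  simp only [Finset.mem_insert, Finset.mem_singleton, exists_eq_or_imp, exists_eq_left]

end FingerReachUnion

end

end Summit.CriticalPhenomena.PercolationContinuityZ3.Theorems
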